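import Summits.Langlands.Langlands.Theorems.RamifiedCoefficientSeedAdjointLiftingGL3StubLocalInertialTypeArith
import Summits.Langlands.Langlands.Theorems.RamifiedCoefficientSeedAdjointLiftingGL3StubInertiaOrderTeichHelpers
import Literature.NumberTheory.GaloisRepresentations.ModPGaloisRepPowProofs
import HarnessLib

/-!
# Crux `AdjointLiftingGL3` (stmt-Langlands-16779), line `birth`: stub `stub_localInertialType`,
# part 2 — the arithmetic core

Second helper file of stub `stub_localInertialType` (CORE-A of S2a, skeleton v6): the registered
sub-goal `localInertialType_core`.  Let `B` be Fontaine–Laffaille blocks of digit multiset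
`{0, 1, 2}` (`flBlockDigits`), `x = ω^c` on `I_K` with `x(σ)` among the block characters
(`flBlockCharacters`) at every `σ ∈ I_K`, and suppose that at some `σ₂` with `ζ = ψ₂(σ₂)` a
primitive `(q² − 1)`-th root of unity the block characters take the values `{x, x ζ^L, x ζ^{-L}}`.
Then `(q − 1) ∣ c + 1` (i.e. `x = ω⁻¹`, clause (E) of the stub) and `L ≡ ±(q + 1)` or
`L ≡ ±(q − 1)` modulo `q² − 1`.  Proof: every block has level `≤ 3` (three digits); the normal form
`flBlocks_decomp` (part 1) leaves three patterns; a level-three block is excluded at a `σ₃` with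
`ψ₃(σ₃)` of order `q³ − 1` (`exists_isPrimitiveRoot_fundamentalCharacter`, `arith_level3`, using
`ω = ψ₃^{q²+q+1}`); the patterns `1+1+1` and `2+1` are `arith_R111`, `arith_R21` applied to the
congruences `trio` read off at `σ₂` (`ω = ψ₂^{q+1}`, `fundamentalCharacter_pow_holds`).

References: Fontaine–Laffaille 1982 Thm. 5.3 (iii); Serre 1972 §1.7; Serre 1987 §2.1–2.4.
-/

set_option linter.dupNamespace false -- `Summit.Langlands.Langlands` is the mandated namespace

noncomputable section

namespace Summit.Langlands.Langlands.Cruxes.AdjointLiftingGL3.Birth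

open scoped MatrixGroups
open Field ValuativeRel
open Literature.NumberTheory.GaloisRepresentations
open Literature.NumberTheory.GaloisRepresentations.IsNonarchimedeanLocalField

/-! ## The arithmetic core of `stub_localInertialType` -/

section Core

/-- **The exponent arithmetic of CORE-A.**  Let `B` be Fontaine–Laffaille blocks of digit multiset
`{0, 1, 2}`, `x = ω^c` on `I_K` (`ω = ψ₁`) with `x(σ)` among the block characters at every
`σ ∈ I_K`, and suppose that at some `σ₂` with `ζ = ψ₂(σ₂)` a primitive `(q² − 1)`-th root of unity
the block characters take the values `{x, x ζ^L, x ζ^{-L}}`.  Then `(q − 1) ∣ c + 1` (i.e.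
`x = ω⁻¹` on `I_K`) and `L ≡ ±(q + 1)` or `L ≡ ±(q − 1)` modulo `q² − 1`.  (A level-three block is
excluded at a `σ₃` with `ψ₃(σ₃)` of order `q³ − 1`; two level-one blocks or one level-two block
remain after matching `x` with a level-one block of digit `1`.)
[cite: FontaineLaffaille1982, Thm. 5.3 (iii)] [cite: Serre1987, §2.2–2.4] -/
theorem localInertialType_core :
    ∀ (K : Type) [Field K] [ValuativeRel K] [TopologicalSpace K] [IsNonarchimedeanLocalField K]
      (k : Type) [Field k], 11 ≤ residueFieldCard K →
      ∀ (ι : absIntegers (↥(ValuativeRel.valuation K).integer) K ⧸ absMaximalIdeal K →+* k)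
        (ϖ : ↥(ValuativeRel.valuation K).integer) (hϖ : Irreducible ϖ)
        (B : List (Σ h : ℕ, Fin h → ℤ)), flBlockDigits B = {0, 1, 2} →
      ∀ (c : ℕ) (x : ↥(absInertia K) → kˣ),
        (∀ σ, x σ = fundamentalCharacter K 1 ι ϖ hϖ σ ^ c) →
        (∀ σ, x σ ∈ (flBlockCharacters K ι ϖ hϖ B).map (fun δ => δ σ)) →
      ∀ (σ₂ : ↥(absInertia K)),
        IsPrimitiveRoot (fundamentalCharacter K 2 ι ϖ hϖ σ₂) (residueFieldCard K ^ 2 - 1) →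
      ∀ (L : ℤ), (flBlockCharacters K ι ϖ hϖ B).map (fun δ => δ σ₂) =
          {x σ₂, x σ₂ * fundamentalCharacter K 2 ι ϖ hϖ σ₂ ^ L,
            x σ₂ * (fundamentalCharacter K 2 ι ϖ hϖ σ₂ ^ L)⁻¹} →
      ((residueFieldCard K : ℤ) - 1 ∣ (c : ℤ) + 1) ∧
        ((residueFieldCard K : ℤ) ^ 2 - 1 ∣ L - ((residueFieldCard K : ℤ) + 1) ∨
          (residueFieldCard K : ℤ) ^ 2 - 1 ∣ L + ((residueFieldCard K : ℤ) + 1) ∨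
          (residueFieldCard K : ℤ) ^ 2 - 1 ∣ L - ((residueFieldCard K : ℤ) - 1) ∨
          (residueFieldCard K : ℤ) ^ 2 - 1 ∣ L + ((residueFieldCard K : ℤ) - 1)) := by
  intro K _ _ _ _ k _ hq ι ϖ hϖ B hdig c x hx hmem σ₂ hζ L h2
  classical
  set q := residueFieldCard K with hqdef
  set ψ₁ := fundamentalCharacter K 1 ι ϖ hϖ with hψ₁
  set ψ₂ := fundamentalCharacter K 2 ι ϖ hϖ with hψ₂
  set ψ₃ := fundamentalCharacter K 3 ι ϖ hϖ with hψ₃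
  set ζ := ψ₂ σ₂ with hζdef
  have hq' : (11 : ℤ) ≤ q := by exact_mod_cast hq
  have hq1 : 1 ≤ q := by omega
  -- `ω = ψ₂ ^ (q + 1) = ψ₃ ^ (q² + q + 1)`
  have hpow2 : ψ₂ ^ (q + 1) = ψ₁ := by
    have h := fundamentalCharacter_pow_holds K 2 two_ne_zero ι ϖ hϖ
    have e : (q ^ 2 - 1) / (q - 1) = q + 1 := by
      have : q ^ 2 - 1 = (q - 1) * (q + 1) := by
        zify [Nat.one_le_pow 2 q hq1, hq1]; ring
      rw [this, Nat.mul_div_cancel_left _ (by omega)]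
    rwa [e] at h
  have hpow3 : ψ₃ ^ (q ^ 2 + q + 1) = ψ₁ := by
    have h := fundamentalCharacter_pow_holds K 3 (by norm_num) ι ϖ hϖ
    have e : (q ^ 3 - 1) / (q - 1) = q ^ 2 + q + 1 := by
      have : q ^ 3 - 1 = (q - 1) * (q ^ 2 + q + 1) := by
        zify [Nat.one_le_pow 3 q hq1, hq1]; ring
      rw [this, Nat.mul_div_cancel_left _ (by omega)]
    rwa [e] at h
  have hN : ((q ^ 2 - 1 : ℕ) : ℤ) = (q : ℤ) ^ 2 - 1 := by
    rw [Nat.cast_sub (Nat.one_le_pow _ _ hq1)]; push_cast; ring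
  have hNf : (q : ℤ) ^ 2 - 1 = ((q : ℤ) + 1) * ((q : ℤ) - 1) := by ring
  have hw : ψ₁ σ₂ = ζ ^ (q + 1) := by rw [← hpow2, MonoidHom.pow_apply]
  have hxζ : x σ₂ = ζ ^ (((q : ℤ) + 1) * c) := by
    rw [hx, hw, ← pow_mul, ← zpow_natCast]; push_cast; ring_nf
  -- every block has level `≤ 3`
  have hcard : Multiset.card (flBlockDigits B) = 3 := by rw [hdig]; rfl
  have hB : ∀ b ∈ B, b.1 ≤ 3 := fun b hb => by
    have h := List.le_sum_of_mem (List.mem_map_of_mem (f := fun b : (Σ h : ℕ, Fin h → ℤ) => b.1) hb)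
    rwa [← card_flBlockDigits, hcard] at h
  obtain ⟨L₁, L₂, L₃, hD, hC⟩ := flBlocks_decomp K ι ϖ hϖ B hB
  have hcards : Multiset.card L₁ + 2 * Multiset.card L₂ + 3 * Multiset.card L₃ = 3 := by
    have h := congrArg Multiset.card hD
    rw [hcard, Multiset.card_add, Multiset.card_add, Multiset.card_bind, Multiset.card_bind] at h
    have e2 : L₂.map (Multiset.card ∘ fun e : ℤ × ℤ => ({e.1, e.2} : Multiset ℤ)) =
        L₂.map (fun _ => 2) := Multiset.map_congr rfl (fun e _ => rfl)
    have e3 : L₃.map (Multiset.card ∘ fun d : Fin 3 → ℤ => (Finset.univ : Finset (Fin 3)).val.map d) =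
        L₃.map (fun _ => 3) := Multiset.map_congr rfl (fun d _ => by simp)
    rw [e2, e3, Multiset.map_const', Multiset.map_const', Multiset.sum_replicate,
      Multiset.sum_replicate, smul_eq_mul, smul_eq_mul] at h
    omega
  rcases (by omega : (Multiset.card L₃ = 1 ∧ Multiset.card L₂ = 0 ∧ Multiset.card L₁ = 0) ∨
      (Multiset.card L₃ = 0 ∧ Multiset.card L₂ = 0 ∧ Multiset.card L₁ = 3) ∨
      (Multiset.card L₃ = 0 ∧ Multiset.card L₂ = 1 ∧ Multiset.card L₁ = 1)) with
    ⟨h3, h2', h1'⟩ | ⟨h3, h2', -⟩ | ⟨h3, h2', h1'⟩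
  · ---------------------------------------------------------------- a level-three block
    exfalso
    obtain ⟨d, rfl⟩ := Multiset.card_eq_one.mp h3
    rw [Multiset.card_eq_zero] at h2' h1'
    subst h2' h1'
    simp only [Multiset.zero_bind, Multiset.map_zero, zero_add, Multiset.singleton_bind] at hD hC
    obtain ⟨σ₃, hξ⟩ := exists_isPrimitiveRoot_fundamentalCharacter (by norm_num : (3 : ℕ) ≠ 0) ι ϖ hϖ
    rw [IsPrimitiveRoot.coe_units_iff] at hξ
    set ξ := ψ₃ σ₃ with hξdef
    have hm := hmem σ₃
    rw [hC, Multiset.map_map, Multiset.mem_map] at hm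
    obtain ⟨j, -, hj⟩ := hm
    rw [Function.comp_apply, MonoidHom.zpow_apply, hx, ← hpow3, MonoidHom.pow_apply, ← pow_mul,
      ← zpow_natCast] at hj
    have hdvd : ((q ^ 3 - 1 : ℕ) : ℤ) ∣ (((q ^ 2 + q + 1) * c : ℕ) : ℤ) -
        -(∑ m : Fin 3, d ⟨(j.val + m.val) % 3, Nat.mod_lt _ (Fin.pos j)⟩ * ((q : ℤ) ^ m.val)) :=
      (hξ.zpow_eq_one_iff_dvd _).mp (by rw [zpow_sub, hj, mul_inv_cancel])
    rw [Nat.cast_sub (Nat.one_le_pow _ _ hq1), sub_neg_eq_add] at hdvd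
    push_cast at hdvd
    -- the digits `f m = d ((j + m) % 3)` are pairwise distinct elements of `{0, 1, 2}`
    set f : Fin 3 → ℤ := fun m => d ⟨(j.val + m.val) % 3, Nat.mod_lt _ (Fin.pos j)⟩ with hf
    have hdD : (Finset.univ : Finset (Fin 3)).val.map d = {0, 1, 2} := by rw [← hD, hdig]
    have hfm : ∀ m, f m = 0 ∨ f m = 1 ∨ f m = 2 := fun m => by
      have : f m ∈ (Finset.univ : Finset (Fin 3)).val.map d :=
        Multiset.mem_map_of_mem _ (Finset.mem_univ_val _)
      rw [hdD] at this
      simpa using this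
    have hinj : ∀ a ∈ (Finset.univ : Finset (Fin 3)).val, ∀ b ∈ (Finset.univ : Finset (Fin 3)).val,
        d a = d b → a = b :=
      Multiset.inj_on_of_nodup_map (by rw [hdD]; decide)
    have hfi : ∀ m m' : Fin 3, f m = f m' → m = m' := fun m m' hmm' => by
      have h := hinj _ (Finset.mem_univ_val _) _ (Finset.mem_univ_val _) hmm'
      simp only [Fin.mk.injEq] at h
      omega
    refine arith_level3 hq' (hfm 0) (hfm 1) (hfm 2) (fun h => absurd (hfi 0 1 h) (by decide))
      (fun h => absurd (hfi 0 2 h) (by decide)) (fun h => absurd (hfi 1 2 h) (by decide))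
      (e := ∑ m : Fin 3, d ⟨(j.val + m.val) % 3, Nat.mod_lt _ (Fin.pos j)⟩ * ((q : ℤ) ^ m.val))
      (c := c) ?_ ?_
    · simp only [hf, Fin.sum_univ_three, Fin.val_zero, Fin.val_one, Fin.val_two, pow_zero, mul_one,
        pow_one]
    · convert hdvd using 1
  · ---------------------------------------------------------------- three level-one blocks
    rw [Multiset.card_eq_zero] at h3 h2'
    subst h3 h2'
    simp only [Multiset.zero_bind, add_zero] at hD hC
    rw [hdig] at hD
    rw [← hD] at hC
    rw [hC] at h2
    have h2'' : ({(ψ₁ ^ (-(0 : ℤ))) σ₂, (ψ₁ ^ (-(1 : ℤ))) σ₂, (ψ₁ ^ (-(2 : ℤ))) σ₂} : Multiset kˣ) =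
        {x σ₂, x σ₂ * ζ ^ L, x σ₂ * (ζ ^ L)⁻¹} := h2
    have T := trio hζ (E₁ := ((q : ℤ) + 1) * (-0)) (E₂ := ((q : ℤ) + 1) * (-1))
      (E₃ := ((q : ℤ) + 1) * (-2)) (F₁ := ((q : ℤ) + 1) * c) (F₂ := ((q : ℤ) + 1) * c + L)
      (F₃ := ((q : ℤ) + 1) * c + -L) h2''
      (by rw [MonoidHom.zpow_apply]; exact zpow_of_eq_pow hw _ (by push_cast; ring))
      (by rw [MonoidHom.zpow_apply]; exact zpow_of_eq_pow hw _ (by push_cast; ring))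
      (by rw [MonoidHom.zpow_apply]; exact zpow_of_eq_pow hw _ (by push_cast; ring))
      hxζ (by rw [hxζ, ← zpow_add]) (by rw [hxζ, ← zpow_neg, ← zpow_add])
    rw [hN] at T
    exact arith_R111 hq' hNf rfl rfl rfl rfl rfl rfl T
  · ---------------------------------------------------------------- a level-two and a level-one block
    rw [Multiset.card_eq_zero] at h3
    subst h3
    obtain ⟨⟨d₀, d₁⟩, rfl⟩ := Multiset.card_eq_one.mp h2'
    obtain ⟨d₂, rfl⟩ := Multiset.card_eq_one.mp h1'
    simp only [Multiset.zero_bind, add_zero, Multiset.singleton_bind, Multiset.map_singleton] at hD hC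
    rw [hC] at h2
    have hd : ({d₂, d₀, d₁} : Multiset ℤ) = {0, 1, 2} := by rw [← hdig, hD]; rfl
    have h2'' : ({(ψ₁ ^ (-d₂)) σ₂, (ψ₂ ^ (-(d₀ + d₁ * (q : ℤ)))) σ₂,
        (ψ₂ ^ (-(d₁ + d₀ * (q : ℤ)))) σ₂} : Multiset kˣ) =
        {x σ₂, x σ₂ * ζ ^ L, x σ₂ * (ζ ^ L)⁻¹} := h2
    have T := trio hζ (E₁ := ((q : ℤ) + 1) * (-d₂)) (E₂ := -(d₀ + d₁ * (q : ℤ)))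
      (E₃ := -(d₁ + d₀ * (q : ℤ))) (F₁ := ((q : ℤ) + 1) * c) (F₂ := ((q : ℤ) + 1) * c + L)
      (F₃ := ((q : ℤ) + 1) * c + -L) h2''
      (by rw [MonoidHom.zpow_apply]; exact zpow_of_eq_pow hw _ (by push_cast; ring))
      (by rw [MonoidHom.zpow_apply]) (by rw [MonoidHom.zpow_apply])
      hxζ (by rw [hxζ, ← zpow_add]) (by rw [hxζ, ← zpow_neg, ← zpow_add])
    rw [hN] at T
    exact arith_R21 hq' hNf hd rfl rfl rfl rfl rfl rfl T

end Core

end Summit.Langlands.Langlands.Cruxes.AdjointLiftingGL3.Birth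

end
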